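import Literature.Computability.AlgebraicComplexity.HomDepthFourUpperBound
import Literature.Computability.AlgebraicComplexity.HomogeneousDepthFour
import HarnessLib

/-!
# `0/1`-substitutions of homogeneous `ΣΠΣΠ` circuits and the reduction of Kumar–Saraf's bound to
its combinatorial core with all-ones matrices (Kumar–Saraf 2017, §8.1: the matrices `J`)

Topic `Literature/Computability/AlgebraicComplexity`; infrastructure for the printed proof of
`kumarSaraf2017_imm_homDepthFour` (`HomogeneousDepthFour.lean`). Kumar–Saraf prove their bound
for `IMM^*` (§8.1): the tuple of `n` generic matrices in which the last matrix of every block is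
replaced by "the all `1`s matrix that we call `J`", the other variables outside a random set `V`
being set to `0` (§8.3). Setting variables to `1` is not a zero-restriction, so this file extends
the circuit side (`HomDepthFourUpperBound.lean`, zero-restrictions `restrictVars`) to
`0/1`-substitutions:

* `substVars J V` — `x_v ↦ 1` (`v ∈ J`), `x_v ↦ x_v` (`v ∈ V`, `v ∉ J`), `x_v ↦ 0` otherwise, a
  `k`-algebra endomorphism; `eraseVars J β` — the exponent vector `β` with the `J`-variables
  removed; `substVars_monomial`, `mem_support_substVars`, `totalDegree_substVars_le`.
* `KumarSaraf.suppLE_substVars_of_isBottomFactor` — under the event "every bottom monomial whose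
  non-`J` variables all lie in `V` has at most `s` non-`J` variables", every substituted bottom
  factor has bottom support `≤ s` (deterministic content of Lemma 8.2 for `IMM^*`).
* **`KumarSaraf.pspDim_subst_le`** — for a homogeneous depth-4 circuit computing `f`
  (homogeneous of degree `n ≥ 2`): `Φ_{ℳ,m}(ρ_{J,V} f) ≤ size · #{A ⊆ [2n/s+1] : |A| ≤ r} ·
  ∑_{i≤rs} C(N, m+i)` — the substitution only lowers degrees and supports of the factors of the
  normal form (3.1) of the ORIGINAL homogeneous circuit, so the merging bound `l ≤ 2n/s + 1` of
  Lemma 4.1 survives (`KumarSaraf.exists_merge` uses `∑ deg ≤ n` only).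
* `KSCore01` (displayed predicate, not assumed) and
  **`kumarSaraf2017_imm_homDepthFour_of_core01`** — the named fact follows from the combinatorial
  core about `IMM` with `0/1`-substitutions: for every family `B` of at most `⌈n^{ε√n}⌉` sets of
  more than `s` variables there are `J, V` such that no member of `B` minus `J` fits inside `V` and
  `Φ(ρ_{J,V} IMM_{n^c,n}) > ⌈n^{ε√n}⌉ · (…)`. This is the exact shape delivered by [KS] (Lemma 8.2 with
  the `J` matrices of `IMM^*`, Lemma 8.9), and it supersedes the zero-restriction core `KSCore` of
  `HomDepthFourReduction.lean` (the case `J = ∅`).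

Everything is proved (D-0026: no named facts).

## References

* M. Kumar, S. Saraf, *On the power of homogeneous depth 4 arithmetic circuits*, SIAM J. Comput.
  46 (2017) 336–387 (arXiv:1404.1950): §8.1 (`IMM^*`, `J`), §8.3, Lemma 8.2, Thm. 8.10 (proof).
-/

noncomputable section

open MvPolynomial

namespace Literature.Computability.AlgebraicComplexity

/-! ### `0/1`-substitutions -/

section Subst

variable {k : Type*} [CommSemiring k] {σ : Type*} [DecidableEq σ]

/-- **The `0/1`-substitution `ρ_{J,V}`**: the variables of `J` are set to `1` (the all-ones
matrices `J` of `IMM^*`), those of `V` (outside `J`) are kept, all others are set to `0`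
(Kumar–Saraf 2017, §8.1 and §8.3). [cite: KumarSaraf2017, §8.1 and §8.3] -/
def substVars (J V : Finset σ) : MvPolynomial σ k →ₐ[k] MvPolynomial σ k :=
  aeval fun v => if v ∈ J then 1 else if v ∈ V then X v else 0

/-- The exponent vector with the `J`-variables removed. [cite: KumarSaraf2017, §8.1] -/
def eraseVars (J : Finset σ) (β : σ →₀ ℕ) : σ →₀ ℕ :=
  β.filter fun x => x ∉ J

/-- The support of the erased exponent vector. [folklore] -/
theorem support_eraseVars (J : Finset σ) (β : σ →₀ ℕ) :
    (eraseVars J β).support = β.support \ J := by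
  ext x
  rw [eraseVars, Finsupp.support_filter, Finset.mem_filter, Finset.mem_sdiff]

/-- Erasing variables does not increase the degree. [folklore] -/
theorem degree_eraseVars_le (J : Finset σ) (β : σ →₀ ℕ) : (eraseVars J β).degree ≤ β.degree := by
  rw [Finsupp.degree_apply, Finsupp.degree_apply, support_eraseVars]
  calc ∑ x ∈ β.support \ J, (eraseVars J β) x = ∑ x ∈ β.support \ J, β x := by
        refine Finset.sum_congr rfl fun x hx => ?_
        rw [eraseVars, Finsupp.filter_apply, if_pos (Finset.mem_sdiff.1 hx).2]
    _ ≤ ∑ x ∈ β.support, β x :=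
        Finset.sum_le_sum_of_subset_of_nonneg Finset.sdiff_subset fun _ _ _ => Nat.zero_le _

/-- **Substitution of a monomial**: `ρ_{J,V}(c x^β) = c x^{β ∖ J}` if every non-`J` variable of
`x^β` lies in `V`, and `0` otherwise. [cite: KumarSaraf2017, §8.3] -/
theorem substVars_monomial (J V : Finset σ) (β : σ →₀ ℕ) (c : k) :
    substVars J V (monomial β c) =
      if β.support \ J ⊆ V then monomial (eraseVars J β) c else 0 := by
  unfold substVars
  rw [aeval_monomial, algebraMap_eq, Finsupp.prod]
  -- the `J`-variables contribute `1`
  have hsplit : ∏ x ∈ β.support, (if x ∈ J then (1 : MvPolynomial σ k) else if x ∈ V then X x else 0) ^ β x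
      = ∏ x ∈ β.support \ J, (if x ∈ V then X x else 0) ^ β x := by
    rw [Finset.sdiff_eq_filter, Finset.prod_filter]
    refine Finset.prod_congr rfl fun x _ => ?_
    by_cases hx : x ∈ J
    · rw [if_pos hx, one_pow, if_neg (not_not.2 hx)]
    · rw [if_neg hx, if_pos hx]
  rw [hsplit]
  split_ifs with h
  · have hmono : ∏ x ∈ β.support \ J, (if x ∈ V then X x else (0 : MvPolynomial σ k)) ^ β x =
        monomial (eraseVars J β) 1 := by
      rw [← prod_X_pow_eq_monomial, support_eraseVars]
      refine Finset.prod_congr rfl fun x hx => ?_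
      rw [if_pos (h hx), eraseVars, Finsupp.filter_apply, if_pos (Finset.mem_sdiff.1 hx).2]
    rw [hmono, C_mul_monomial, mul_one]
  · obtain ⟨x, hx, hxV⟩ := Finset.not_subset.1 h
    rw [Finset.prod_eq_zero hx, mul_zero]
    rw [if_neg hxV, zero_pow (Finsupp.mem_support_iff.1 (Finset.mem_sdiff.1 hx).1)]

/-- The support of a substituted polynomial: erased exponent vectors of surviving monomials.
[cite: KumarSaraf2017, §8.3] -/
theorem mem_support_substVars {J V : Finset σ} {f : MvPolynomial σ k} {γ : σ →₀ ℕ}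
    (hγ : γ ∈ (substVars J V f).support) :
    ∃ β ∈ f.support, β.support \ J ⊆ V ∧ γ = eraseVars J β := by
  classical
  have h : substVars J V f = ∑ β ∈ f.support, substVars J V (monomial β (coeff β f)) := by
    conv_lhs => rw [f.as_sum, map_sum]
  rw [h] at hγ
  obtain ⟨β, hβ, hγβ⟩ := Finset.mem_biUnion.1 (support_sum hγ)
  rw [substVars_monomial] at hγβ
  split_ifs at hγβ with hsub
  · refine ⟨β, hβ, hsub, ?_⟩
    have := support_monomial_subset hγβ
    rwa [Finset.mem_singleton] at this
  · simp at hγβ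

/-- Substitution does not increase the total degree. [cite: KumarSaraf2017, §8.3] -/
theorem totalDegree_substVars_le (J V : Finset σ) (f : MvPolynomial σ k) :
    (substVars J V f).totalDegree ≤ f.totalDegree := by
  rw [totalDegree, Finset.sup_le_iff]
  intro γ hγ
  obtain ⟨β, hβ, -, rfl⟩ := mem_support_substVars hγ
  calc ((eraseVars J β).sum fun _ e => e) = (eraseVars J β).degree := (Finsupp.degree_apply _).symm
    _ ≤ β.degree := degree_eraseVars_le J β
    _ = β.sum (fun _ e => e) := Finsupp.degree_apply _
    _ ≤ f.totalDegree := le_totalDegree hβ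

end Subst

/-! ### The circuit-side upper bound under a `0/1`-substitution -/

namespace KumarSaraf

open GKKS ArithCircuit

variable {K : Type*} [Field K] {σ : Type*} [DecidableEq σ]

/-- **`ρ_{J,V}(C)` is a `ΣΠΣΠ^{{s}}` circuit** (deterministic content of Kumar–Saraf 2017,
Lemma 8.2, for `IMM^*`): if every bottom monomial of `P` whose non-`J` variables all lie in `V` has
at most `s` non-`J` variables (`s ≥ 1`), every substituted bottom factor has bottom support `≤ s`.
[cite: KumarSaraf2017, Lemma 8.2] -/
theorem suppLE_substVars_of_isBottomFactor {P : ArithCircuit K σ} {q : MvPolynomial σ K}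
    (hq : P.IsBottomFactor q) (J V : Finset σ) {s : ℕ} (hs : 1 ≤ s)
    (hV : ∀ e ∈ P.monoExps, e.support \ J ⊆ V → (e.support \ J).card ≤ s) :
    SuppLE (substVars J V q) s := by
  intro γ hγ
  obtain ⟨β, hβq, hβV, rfl⟩ := mem_support_substVars hγ
  rw [support_eraseVars]
  rcases hq β hβq with h | h
  · exact hV β h hβV
  · exact (Finset.card_le_card Finset.sdiff_subset).trans
      ((card_support_le_degree β).trans (h.trans hs))

/-- **One product under a `0/1`-substitution** (Kumar–Saraf 2017, Lemma 4.1 for one product gate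
of `ρ_{J,V}(C)`): as `pspDim_restrict_prod_le`, with `restrictVars` replaced by `substVars`.
[cite: KumarSaraf2017, Lemma 4.1] -/
theorem pspDim_subst_prod_le [Fintype σ] {P : ArithCircuit K σ} {q : MvPolynomial σ K} {n : ℕ}
    (hq0 : q ≠ 0) (hqn : q.IsHomogeneous n) {L : List (MvPolynomial σ K)}
    (hL : ∀ g ∈ L, P.IsBottomFactor g ∧ ∃ e, g.IsHomogeneous e) (hqL : q = L.prod)
    (J V : Finset σ) {s : ℕ} (hs : 1 ≤ s)
    (hV : ∀ e ∈ P.monoExps, e.support \ J ⊆ V → (e.support \ J).card ≤ s)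
    {ι : Type*} [Fintype ι] (Ls : ι → List σ) (r : ℕ) (hLs : ∀ i, (Ls i).length = r) (m : ℕ) :
    pspDim Ls m (substVars J V q) ≤
      numSubsetsLE (2 * n / s + 1) r *
        ∑ i ∈ Finset.range (r * s + 1), (Fintype.card σ).choose (m + i) := by
  classical
  have hne : ∀ g ∈ L, g ≠ 0 := fun g hg h0 => hq0 (by rw [hqL]; exact List.prod_eq_zero (h0 ▸ hg))
  have hhom : ∀ g ∈ L, (g : MvPolynomial σ K).IsHomogeneous (totalDegree g) := fun g hg => by
    obtain ⟨e, he⟩ := (hL g hg).2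
    rwa [he.totalDegree (hne g hg)]
  have hsum : (L.map totalDegree).sum = n := by
    have h1 := isHomogeneous_list_prod L totalDegree hhom
    rw [← hqL] at h1
    exact h1.inj_right hqn hq0
  have hres : substVars J V q = (L.map (substVars J V)).prod := by rw [hqL, map_list_prod]
  have hL1 : ∀ p ∈ L.map (substVars J V), SuppLE p s := by
    intro p hp
    obtain ⟨g, hg, rfl⟩ := List.mem_map.1 hp
    exact suppLE_substVars_of_isBottomFactor (hL g hg).1 J V hs hV
  have hL2 : ((L.map (substVars J V)).map totalDegree).sum ≤ n := by
    rw [← hsum, List.map_map]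
    exact List.sum_le_sum fun g _ => totalDegree_substVars_le J V g
  obtain ⟨L', hprod, hL', hlen⟩ := exists_merge hs _ hL1 hL2
  rw [hres, ← hprod, ← Fin.prod_univ_getElem L']
  calc pspDim Ls m (∏ j : Fin L'.length, L'[(j : ℕ)])
      ≤ numSubsetsLE L'.length r *
          ∑ i ∈ Finset.range (r * s + 1), (Fintype.card σ).choose (m + i) :=
        pspDim_prod_le Ls r hLs (fun j : Fin L'.length => L'[(j : ℕ)])
          (fun j => hL' _ (List.getElem_mem _)) m
    _ ≤ _ := Nat.mul_le_mul_right _ (numSubsetsLE_mono hlen r)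

/-- **Kumar–Saraf 2017, eq. (4.1) of the proof of Thm. 8.10 for `IMM^*` (with the all-ones
matrices), in the tree's model**: for a homogeneous depth-4 circuit `P` computing `f`
(homogeneous of degree `n ≥ 2`) and `J, V` such that every bottom monomial of `P` whose non-`J`
variables all lie in `V` has at most `s ≥ 1` non-`J` variables,
`Φ_{ℳ,m}(ρ_{J,V} f) ≤ size(P) · #{A ⊆ [2n/s+1] : |A| ≤ r} · ∑_{i ≤ rs} C(N, m+i)`.
[cite: KumarSaraf2017, Lemma 4.1 and Thm. 8.10 (4.1)] -/
theorem pspDim_subst_le [Fintype σ] {P : ArithCircuit K σ} {f : MvPolynomial σ K}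
    (hc : P.Computes f) (h4 : P.IsDepthFour) (hh : P.IsHomogeneousCircuit) {n : ℕ}
    (hf : f.IsHomogeneous n) (hn : 2 ≤ n) (J V : Finset σ) {s : ℕ} (hs : 1 ≤ s)
    (hV : ∀ e ∈ P.monoExps, e.support \ J ⊆ V → (e.support \ J).card ≤ s)
    {ι : Type*} [Fintype ι] (Ls : ι → List σ) (r : ℕ) (hLs : ∀ i, (Ls i).length = r) (m : ℕ) :
    pspDim Ls m (substVars J V f) ≤
      P.size * (numSubsetsLE (2 * n / s + 1) r *
        ∑ i ∈ Finset.range (r * s + 1), (Fintype.card σ).choose (m + i)) := by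
  classical
  obtain ⟨Q, c, hQ, hfQ, hprops⟩ := exists_sum_prod hc h4 hh hf hn
  set B := numSubsetsLE (2 * n / s + 1) r *
    ∑ i ∈ Finset.range (r * s + 1), (Fintype.card σ).choose (m + i) with hB
  have hres : substVars J V f = ∑ q ∈ Q, c q • substVars J V q := by
    rw [hfQ, map_sum]
    exact Finset.sum_congr rfl fun q _ => map_smul _ _ _
  rw [hres]
  calc pspDim Ls m (∑ q ∈ Q, c q • substVars J V q)
      ≤ ∑ q ∈ Q, pspDim Ls m (substVars J V q) := pspDim_sum_smul_le Ls m Q c _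
    _ ≤ ∑ _q ∈ Q, B := Finset.sum_le_sum fun q hq => by
        obtain ⟨hq0, hqn, L, hL, hqL⟩ := hprops q hq
        exact pspDim_subst_prod_le hq0 hqn hL hqL J V hs hV Ls r hLs m
    _ = Q.card * B := by rw [Finset.sum_const, smul_eq_mul]
    _ ≤ P.size * B := Nat.mul_le_mul_right B hQ

end KumarSaraf

/-! ### The reduction to the combinatorial core with all-ones matrices -/

open KumarSaraf GKKS ArithCircuit

/-- **The combinatorial core of Kumar–Saraf's Thm. 8.10 with the all-ones matrices `J`**, as a
displayed hypothesis shape (a predicate; NOT a named fact and not assumed anywhere): for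
`n ≥ n₀` there is `s ≥ 1` such that every family `B` of at most `⌈n^{ε√n}⌉` sets of variables of
`IMM_{n^c,n}` is answered by sets `J` (variables set to `1`) and `V` (variables kept) such that no
`A ∈ B` with more than `s` non-`J` variables has all its non-`J` variables in `V`, and, for some
derivative operators of a common order `r` and some shift degree `m`,
`Φ(ρ_{J,V} IMM_{n^c,n}) > ⌈n^{ε√n}⌉ · #{A ⊆ [2n/s+1] : |A| ≤ r} · ∑_{i ≤ rs} C(N, m+i)`. In print
`J` = the variables of the matrices `J` of `IMM^*` (§8.1) and `V ← 𝒟` (§8.3); Lemma 8.2 and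
Lemma 8.9 give such `J, V` by the union bound. [cite: KumarSaraf2017, Lemma 8.2 and Lemma 8.9] -/
def KSCore01 (K : Type) [Field K] (c n₀ : ℕ) (ε : ℝ) : Prop :=
  ∀ n : ℕ, n₀ ≤ n → ∃ s : ℕ, 1 ≤ s ∧
    ∀ B : Finset (Finset (Fin n × Fin (n ^ c) × Fin (n ^ c))),
      B.card ≤ ⌈(n : ℝ) ^ (ε * Real.sqrt n)⌉₊ →
      ∃ (J V : Finset (Fin n × Fin (n ^ c) × Fin (n ^ c))) (r m : ℕ)
        (L : Finset (List (Fin n × Fin (n ^ c) × Fin (n ^ c)))),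
        (∀ l ∈ L, l.length = r) ∧ (∀ A ∈ B, s < (A \ J).card → ¬ (A \ J ⊆ V)) ∧
        ⌈(n : ℝ) ^ (ε * Real.sqrt n)⌉₊ *
            (numSubsetsLE (2 * n / s + 1) r *
              ∑ i ∈ Finset.range (r * s + 1),
                (Fintype.card (Fin n × Fin (n ^ c) × Fin (n ^ c))).choose (m + i)) <
          pspDim (fun l : L => (l : List (Fin n × Fin (n ^ c) × Fin (n ^ c)))) m
            (substVars J V (immPoly (n ^ c) n K))

/-- **The circuit side of Kumar–Saraf 2017, Thm. 8.10, for one `n`, with all-ones matrices**: if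
the core holds at `n ≥ 2` then every homogeneous depth-4 circuit computing `IMM_{n^c,n}` has at
least `⌈n^{ε√n}⌉` gates (as `le_homDepthFourCircuitSize_immPoly_of_core`, with
`KumarSaraf.pspDim_subst_le`). [cite: KumarSaraf2017, Thm. 8.10 (proof)] -/
theorem le_homDepthFourCircuitSize_immPoly_of_core01 {K : Type} [Field K] {c n : ℕ} {ε : ℝ}
    (hn : 2 ≤ n) {s : ℕ} (hs : 1 ≤ s)
    (hcore : ∀ B : Finset (Finset (Fin n × Fin (n ^ c) × Fin (n ^ c))),
      B.card ≤ ⌈(n : ℝ) ^ (ε * Real.sqrt n)⌉₊ →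
      ∃ (J V : Finset (Fin n × Fin (n ^ c) × Fin (n ^ c))) (r m : ℕ)
        (L : Finset (List (Fin n × Fin (n ^ c) × Fin (n ^ c)))),
        (∀ l ∈ L, l.length = r) ∧ (∀ A ∈ B, s < (A \ J).card → ¬ (A \ J ⊆ V)) ∧
        ⌈(n : ℝ) ^ (ε * Real.sqrt n)⌉₊ *
            (numSubsetsLE (2 * n / s + 1) r *
              ∑ i ∈ Finset.range (r * s + 1),
                (Fintype.card (Fin n × Fin (n ^ c) × Fin (n ^ c))).choose (m + i)) <
          pspDim (fun l : L => (l : List (Fin n × Fin (n ^ c) × Fin (n ^ c)))) m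
            (substVars J V (immPoly (n ^ c) n K))) :
    ((⌈(n : ℝ) ^ (ε * Real.sqrt n)⌉₊ : ℕ) : ℕ∞) ≤ homDepthFourCircuitSize (immPoly (n ^ c) n K) := by
  classical
  refine le_iInf₂ fun P hP => ?_
  obtain ⟨hc, h4, hh⟩ := hP
  rw [ENat.coe_le_coe]
  by_contra hlt
  push Not at hlt
  set B : Finset (Finset (Fin n × Fin (n ^ c) × Fin (n ^ c))) := P.monoExps.image Finsupp.support
    with hB
  have hBcard : B.card ≤ ⌈(n : ℝ) ^ (ε * Real.sqrt n)⌉₊ :=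
    calc B.card ≤ P.monoExps.card := Finset.card_image_le
      _ ≤ P.size := P.card_monoExps_le
      _ ≤ _ := hlt.le
  obtain ⟨J, V, r, m, L, hL, hV, hbig⟩ := hcore B hBcard
  have hevent : ∀ e ∈ P.monoExps, e.support \ J ⊆ V → (e.support \ J).card ≤ s := by
    intro e he hsub
    by_contra hgt
    push Not at hgt
    exact hV e.support (Finset.mem_image.2 ⟨e, he, rfl⟩) hgt hsub
  have hup := pspDim_subst_le hc h4 hh (immPoly_isHomogeneous_holds (k := K) (n ^ c) n) hn J V hs
    hevent (fun l : L => (l : List (Fin n × Fin (n ^ c) × Fin (n ^ c)))) r (fun l => hL l l.2) m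
  have := hbig.trans_le hup
  exact absurd (Nat.lt_of_mul_lt_mul_right this) (not_lt.2 hlt.le)

/-- **Kumar–Saraf 2017, Thm. 1.2 / Thm. 8.10 from its combinatorial core with all-ones
matrices.** If for every field `K` there are `c, n₀, ε > 0` with `KSCore01 K c n₀ ε`, then the
named fact `kumarSaraf2017_imm_homDepthFour` holds. What this leaves to prove is exactly the
polynomial side of [KS] for `IMM^*` (§8.3–§8.7, §9, §11–12).
[cite: KumarSaraf2017, Thm. 8.10 (proof)] -/
theorem kumarSaraf2017_imm_homDepthFour_of_core01
    (hcore : ∀ (K : Type) [Field K], ∃ (c n₀ : ℕ) (ε : ℝ), 0 < ε ∧ KSCore01 K c n₀ ε) :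
    kumarSaraf2017_imm_homDepthFour := by
  intro K _
  obtain ⟨c, n₀, ε, hε, h⟩ := hcore K
  refine ⟨c, max n₀ 2, ε, hε, fun n hn => ?_⟩
  obtain ⟨s, hs, hcoreN⟩ := h n ((le_max_left n₀ 2).trans hn)
  exact le_homDepthFourCircuitSize_immPoly_of_core01 ((le_max_right n₀ 2).trans hn) hs hcoreN

end Literature.Computability.AlgebraicComplexity

end
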